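import Summits.CriticalPhenomena.PercolationContinuityZ3.Theorems.Transplant.FKConnectivityAllQForestClusterRepulsion
import Summits.CriticalPhenomena.PercolationContinuityZ3.Theorems.Transplant.FKConnectivityAllQForestEndTriangle
import HarnessLib

/-!
# The square-free adjacent forest Rayleigh node at an END `v` OF DEGREE THREE from CLUSTER REPULSION with `|P| = 2`

Support file (`--supports stmt-CriticalPhenomena-4575`), FK sub-lane `prim-bschramm-fk-1` (gen 27) of the post-continuity programme;
builds on p205010 (kernel theorem, internal audit signed; external expert review pending).  No definitions, no named facts, no sorries;
standard axioms.

NODE (♣)⁰ (`AdjForestRayleighNoSqOn`): on every fibre `(M, u₀)` and for `e = ov`, `f = oy`, `bad := #(Fo ∩ {e, f ∈ ω}, Fo) ≤ good :=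
#(Fo ∩ {e ∈ ω}, Fo ∩ {f ∈ ω})`.  NODE (CR) (`ClusterRepulsionOn`, `…ForestClusterRepulsion.lean`): `#(Fo ∩ {f ∈ ω} ∩ {o ↮ P}, Fo) ≤
#(Fo ∩ {o ↮ P}, Fo ∩ {f ∈ ω})` for every vertex set `P` (`{o ↮ P}` = the open cluster of `o` avoids `P`).

THIS FILE (memo bschramm/FROM-fk-1-g27-CLUSTER-REPULSION.md §2): vertex elimination at the END `v` of `e` when `v` meets exactly the three
FREE pairs `vo, vp, vq` (g23's claw decomposition with the tracked pair `vo`, `fibreCount_forest_claw_decomp_mem`), regrouped along the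
partition `{o ↮ p} = Vₒ ⊔ Dₚ`, `{o ↮ q} = Vₒ ⊔ D_q`, `{p ↮ q} = (Vₒ ∩ {p ↮ q}) ⊔ Dₚ ⊔ D_q`, `{o,p,q pairwise separated} = Vₒ ∩ {p ↮ q}`
(`Vₒ = {o ↮ p, o ↮ q}`, `Dₚ = {o ↮ p, o ~ q}`, `D_q = {o ↮ q, o ~ p}`; **`sep_pq_eq_union`**), gives the IDENTITY
`bad − good = 2·(X − Y)`, `X = #'(Fo ∩ {f ∈ ω} ∩ Vₒ, Fo)`, `Y = #'(Fo ∩ Vₒ, Fo ∩ {f ∈ ω})` on the `v`-deleted fibre — in graph language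
`(bad − good)(G'; o; v, y) = 2·Q_{{p,q}}(G' − v; o, f)` with `Q_P(K; o, f) := Σ_{(A,B)} σ_f·[C_A(o) ∩ P = ∅]`.  Hence
**`adjForestNoSq_fibre_of_degThreeEnd_of_avoid`** (`X ≤ Y ⇒ bad ≤ good`) and **`adjForestNoSq_fibre_of_degThreeEnd`**: `ClusterRepulsionOn V`
⇒ the node's inequality at `(ov, oy)` on every such fibre.  With g23's reductions this CLOSES, modulo (CR) at `|P| = 2`, the frontier class
"degree-3 ends `v, y` with non-adjacent other neighbours" of a minimal counterexample (memo bschramm/FROM-fk-1-g23-VERTEX-ELIMINATION.md §2(iii)).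
Evidence for the identity: 300 random instances (deg `v` = 3, 6–12 vertices), `bad − good` by the node's transfer-matrix engine and `Q` by
the independent (CR) engine: 0 discrepancies; (CR) itself: 0 violations in 8.6·10⁸ exhaustive cells (`n ≤ 7`).
[cite: SempleWelsh2008, Conj. 1.1 (p. 2)] [cite: Linusson2011, Prop. 2.6] [cite: Grimmett2006, §1.5 (p. 13)]
-/

noncomputable section

namespace Summit.CriticalPhenomena.PercolationContinuityZ3.Theorems
namespace FK

open MeasureTheory Set Literature.Probability.LatticeModels Literature.Probability.Percolation
open scoped Classical symmDiff

variable {V : Type*} [Fintype V]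

/-! ### The node at an end `v` of degree three from cluster repulsion with `|P| = 2` -/

section DegThreeEnd

variable {N u₀ : BondConfig V} {v o p q : V} {f : Sym2 V}

/-- The four-way partition behind the degree-3 identity: with `Vₒ := {o ↮ p, o ↮ q}`, `Dₚ := {o ↮ p, o ~ q}`, `D_q := {o ↮ q, o ~ p}` one has
`{o ↮ p} = Vₒ ⊔ Dₚ`, `{o ↮ q} = Vₒ ⊔ D_q`, `{p ↮ q} = (Vₒ ∩ {p ↮ q}) ⊔ Dₚ ⊔ D_q`, `{o ↮ p, o ↮ q, p ↮ q} = Vₒ ∩ {p ↮ q}` (transitivity of `~`).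
This lemma: the `{p ↮ q}` decomposition, as a set identity. [cite: Grimmett2006, §1.5 (p. 13)] -/
theorem sep_pq_eq_union (o p q : V) :
    ({ω | ¬ (openGraph ω).Reachable p q} : Set (BondConfig V)) =
      ({ω | ¬ (openGraph ω).Reachable o p ∧ ¬ (openGraph ω).Reachable o q} ∩ {ω | ¬ (openGraph ω).Reachable p q}) ∪
        ({ω | ¬ (openGraph ω).Reachable o p ∧ (openGraph ω).Reachable o q} ∪
          {ω | ¬ (openGraph ω).Reachable o q ∧ (openGraph ω).Reachable o p}) := by
  ext ω
  simp only [mem_setOf_eq, mem_inter_iff, mem_union]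
  constructor
  · intro hpq
    by_cases hop : (openGraph ω).Reachable o p
    · by_cases hoq : (openGraph ω).Reachable o q
      · exact absurd (hop.symm.trans hoq) hpq
      · exact Or.inr (Or.inr ⟨hoq, hop⟩)
    · by_cases hoq : (openGraph ω).Reachable o q
      · exact Or.inr (Or.inl ⟨hop, hoq⟩)
      · exact Or.inl ⟨⟨hop, hoq⟩, hpq⟩
  · rintro (⟨-, hpq⟩ | ⟨hop, hoq⟩ | ⟨hoq, hop⟩)
    · exact hpq
    · exact fun hpq => hop (hoq.trans hpq.symm)
    · exact fun hpq => hoq (hop.trans hpq)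

/-- **THE DEGREE-THREE END IDENTITY ⇒ REDUCTION.**  Fibre `(N ∪ {vo, vp, vq}, u₀)` with `v` isolated in `N ∪ u₀`, `v, o, p, q` distinct,
`v ∉ f`.  Eliminating `v` (claw decomposition with the tracked pair `vo`) and regrouping the cells by the partition of
`sep_pq_eq_union` gives `bad − good = 2·(X − Y)` with `X = #'(Fo ∩ {f ∈ ω} ∩ {o ↮ p, o ↮ q}, Fo)`, `Y = #'(Fo ∩ {o ↮ p, o ↮ q}, Fo ∩ {f ∈ ω})`
on `(N, u₀)`; hence `X ≤ Y` — cluster repulsion with `P = {p, q}` when `f = oy` — gives the node's inequality `bad ≤ good` at `(vo, f)`.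
[cite: SempleWelsh2008, Conj. 1.1 (p. 2)] [cite: Linusson2011, Prop. 2.6] [cite: Grimmett2006, §1.5 (p. 13)] -/
theorem adjForestNoSq_fibre_of_degThreeEnd_of_avoid (hv : ∀ g ∈ N ∪ u₀, v ∉ g) (hvo : v ≠ o) (hvp : v ≠ p) (hvq : v ≠ q)
    (hop : o ≠ p) (hoq : o ≠ q) (hpq : p ≠ q) (hfv : v ∉ f)
    (H : fibreCount N u₀ (forestEv V ∩ {ω | ¬ (openGraph ω).Reachable o p ∧ ¬ (openGraph ω).Reachable o q} ∩ {ω | f ∈ ω})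
        (forestEv V) ≤
      fibreCount N u₀ (forestEv V ∩ {ω | ¬ (openGraph ω).Reachable o p ∧ ¬ (openGraph ω).Reachable o q})
        (forestEv V ∩ {ω | f ∈ ω})) :
    fibreCount (insert s(v, o) (insert s(v, p) (insert s(v, q) N))) u₀ (forestEv V ∩ {ω | s(o, v) ∈ ω ∧ f ∈ ω}) (forestEv V) ≤
      fibreCount (insert s(v, o) (insert s(v, p) (insert s(v, q) N))) u₀ (forestEv V ∩ {ω | s(o, v) ∈ ω})
        (forestEv V ∩ {ω | f ∈ ω}) := by
  have hov : s(o, v) = s(v, o) := Sym2.eq_swap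
  have hnf : ∀ x : V, s(v, x) ≠ f := fun x h => hfv (h ▸ Sym2.mem_mk_left _ _)
  have hU : ∀ (g : Sym2 V) (ω : BondConfig V), insert g ω ∈ (univ : Set (BondConfig V)) ↔ ω ∈ (univ : Set (BondConfig V)) :=
    fun g ω => by simp only [mem_univ]
  have bf : ∀ x : V, ∀ ω, insert s(v, x) ω ∈ {ω : BondConfig V | f ∈ ω} ↔ ω ∈ {ω : BondConfig V | f ∈ ω} :=
    fun x => insert_mem_pairEv_iff (hnf x)
  -- the decomposition of both sides (cells containing `vo` only)
  have DB := fibreCount_forest_claw_decomp_mem (P := {ω | f ∈ ω}) (Q := univ) hv hvo hvp hvq hop hoq hpq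
    (bf o) (bf p) (bf q) (hU _) (hU _)
  have DG := fibreCount_forest_claw_decomp_mem (P := univ) (Q := {ω | f ∈ ω}) hv hvo hvp hvq hop hoq hpq
    (hU _) (hU _) (hU _) (bf p) (bf q)
  have hB : forestEv V ∩ {ω : BondConfig V | s(o, v) ∈ ω ∧ f ∈ ω} = forestEv V ∩ ({ω | s(v, o) ∈ ω} ∩ {ω | f ∈ ω}) := by
    rw [hov]; rfl
  have hG : forestEv V ∩ {ω : BondConfig V | s(o, v) ∈ ω} = forestEv V ∩ ({ω | s(v, o) ∈ ω} ∩ univ) := by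
    rw [hov, Set.inter_univ]
  rw [hB, hG]
  simp only [Set.inter_univ] at DB DG ⊢
  rw [DB, DG]
  -- names for the events on `(N, u₀)`
  set Fo := forestEv V with hFo
  set Pf : Set (BondConfig V) := {ω | f ∈ ω} with hPf
  set Sop : Set (BondConfig V) := {ω | ¬ (openGraph ω).Reachable o p} with hSop
  set Soq : Set (BondConfig V) := {ω | ¬ (openGraph ω).Reachable o q} with hSoq
  set Spq : Set (BondConfig V) := {ω | ¬ (openGraph ω).Reachable p q} with hSpq
  set Vo : Set (BondConfig V) := {ω | ¬ (openGraph ω).Reachable o p ∧ ¬ (openGraph ω).Reachable o q} with hVo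
  set Dp : Set (BondConfig V) := {ω | ¬ (openGraph ω).Reachable o p ∧ (openGraph ω).Reachable o q} with hDp
  set Dq : Set (BondConfig V) := {ω | ¬ (openGraph ω).Reachable o q ∧ (openGraph ω).Reachable o p} with hDq
  -- the set identities
  have eOpq : ({ω | ¬ (openGraph ω).Reachable o p ∧ ¬ (openGraph ω).Reachable o q ∧ ¬ (openGraph ω).Reachable p q} :
      Set (BondConfig V)) = Vo ∩ Spq := by
    ext ω; simp only [hVo, hSpq, mem_setOf_eq, mem_inter_iff]; tauto
  have eOp : Sop = Vo ∪ Dp := by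
    ext ω; simp only [hSop, hVo, hDp, mem_setOf_eq, mem_union]; tauto
  have eOq : Soq = Vo ∪ Dq := by
    ext ω; simp only [hSoq, hVo, hDq, mem_setOf_eq, mem_union]; tauto
  have ePq : Spq = (Vo ∩ Spq) ∪ (Dp ∪ Dq) := sep_pq_eq_union o p q
  have dVp : Disjoint Vo Dp := Set.disjoint_left.2 fun ω h₁ h₂ => h₁.2 h₂.2
  have dVq : Disjoint Vo Dq := Set.disjoint_left.2 fun ω h₁ h₂ => h₁.1 h₂.2
  have dpq : Disjoint Dp Dq := Set.disjoint_left.2 fun ω h₁ h₂ => h₁.1 h₂.2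
  have dVpq : Disjoint (Vo ∩ Spq) (Dp ∪ Dq) :=
    Set.disjoint_left.2 fun ω h₁ h₂ => h₂.elim (fun h => h₁.1.2 h.2) (fun h => h₁.1.1 h.2)
  -- distribute the intersections and split the counts
  have splitL : ∀ (A B : Set (BondConfig V)), Disjoint A B → ∀ (Q : Set (BondConfig V)),
      fibreCount N u₀ (Fo ∩ (A ∪ B) ∩ Pf) Q = fibreCount N u₀ (Fo ∩ A ∩ Pf) Q + fibreCount N u₀ (Fo ∩ B ∩ Pf) Q := by
    intro A B hd Q
    rw [show Fo ∩ (A ∪ B) ∩ Pf = (Fo ∩ A ∩ Pf) ∪ (Fo ∩ B ∩ Pf) by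
      rw [Set.inter_union_distrib_left, Set.union_inter_distrib_right]]
    exact fibreCount_split_left N u₀ Q (Set.disjoint_left.2 fun ω h₁ h₂ => hd.le_bot ⟨h₁.1.2, h₂.1.2⟩)
  have splitL' : ∀ (A B : Set (BondConfig V)), Disjoint A B → ∀ (Q : Set (BondConfig V)),
      fibreCount N u₀ (Fo ∩ (A ∪ B)) Q = fibreCount N u₀ (Fo ∩ A) Q + fibreCount N u₀ (Fo ∩ B) Q := by
    intro A B hd Q
    rw [Set.inter_union_distrib_left]
    exact fibreCount_split_left N u₀ Q (Set.disjoint_left.2 fun ω h₁ h₂ => hd.le_bot ⟨h₁.2, h₂.2⟩)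
  -- the `{p ↮ q}` cells, split along `sep_pq_eq_union`
  have sL : fibreCount N u₀ (Fo ∩ Spq) (Fo ∩ Pf) =
      fibreCount N u₀ (Fo ∩ (Vo ∩ Spq)) (Fo ∩ Pf) + (fibreCount N u₀ (Fo ∩ Dp) (Fo ∩ Pf) + fibreCount N u₀ (Fo ∩ Dq) (Fo ∩ Pf)) := by
    conv_lhs => rw [ePq]
    rw [splitL' _ _ dVpq, splitL' _ _ dpq]
  have sR : fibreCount N u₀ (Fo ∩ Spq ∩ Pf) Fo =
      fibreCount N u₀ (Fo ∩ (Vo ∩ Spq) ∩ Pf) Fo + (fibreCount N u₀ (Fo ∩ Dp ∩ Pf) Fo + fibreCount N u₀ (Fo ∩ Dq ∩ Pf) Fo) := by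
    conv_lhs => rw [ePq]
    rw [splitL _ _ dVpq, splitL _ _ dpq]
  -- the two swapped cells `{vo}`
  have sw1 : fibreCount N u₀ (Fo ∩ Pf) (Fo ∩ Spq) = fibreCount N u₀ (Fo ∩ Spq) (Fo ∩ Pf) := fibreCount_swap _ _ _ _
  have sw2 : fibreCount N u₀ Fo (Fo ∩ Spq ∩ Pf) = fibreCount N u₀ (Fo ∩ Spq ∩ Pf) Fo := fibreCount_swap _ _ _ _
  rw [eOpq, sw1, sw2, eOp, eOq, splitL _ _ dVp, splitL _ _ dVq, splitL' _ _ dVp, splitL' _ _ dVq, sL, sR]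
  -- `H` is `X ≤ Y` with `X = #(Fo ∩ Vo ∩ Pf, Fo)`, `Y = #(Fo ∩ Vo, Fo ∩ Pf)`
  have hX : fibreCount N u₀ (Fo ∩ Vo ∩ Pf) Fo ≤ fibreCount N u₀ (Fo ∩ Vo) (Fo ∩ Pf) := H
  omega

/-- **(♣)⁰ AT AN END `v` OF DEGREE THREE ⟸ CLUSTER REPULSION WITH `|P| = 2`.**  If `ClusterRepulsionOn V` holds then the node's
inequality at `(e, f) = (ov, oy)` holds on every fibre `(N ∪ {vo, vp, vq}, u₀)` in which `v` meets exactly the three free pairs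
`vo, vp, vq` (`v, o, p, q` distinct, `y ≠ v`, `u₀` disjoint from `N`).  Graph form: `bad − good = 2·Q_{{p,q}}(G' − v; o, f)`.
[cite: SempleWelsh2008, Conj. 1.1 (p. 2)] [cite: Linusson2011, Prop. 2.6] [cite: Grimmett2006, §1.5 (p. 13)] -/
theorem adjForestNoSq_fibre_of_degThreeEnd (h : ClusterRepulsionOn V) (hd : Disjoint u₀ N) (hv : ∀ g ∈ N ∪ u₀, v ∉ g)
    (hvo : v ≠ o) (hvp : v ≠ p) (hvq : v ≠ q) (hop : o ≠ p) (hoq : o ≠ q) (hpq : p ≠ q) {y : V} (hvy : v ≠ y) :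
    fibreCount (insert s(v, o) (insert s(v, p) (insert s(v, q) N))) u₀ (forestEv V ∩ {ω | s(o, v) ∈ ω ∧ s(o, y) ∈ ω}) (forestEv V) ≤
      fibreCount (insert s(v, o) (insert s(v, p) (insert s(v, q) N))) u₀ (forestEv V ∩ {ω | s(o, v) ∈ ω})
        (forestEv V ∩ {ω | s(o, y) ∈ ω}) := by
  have hfv : v ∉ s(o, y) := fun h' => by
    rcases Sym2.mem_iff.1 h' with h'' | h''
    · exact hvo h''
    · exact hvy h''
  refine adjForestNoSq_fibre_of_degThreeEnd_of_avoid hv hvo hvp hvq hop hoq hpq hfv ?_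
  have key := h N u₀ hd o y {p, q}
  have hVo : (avoidEv o ({p, q} : Set V) : Set (BondConfig V)) =
      {ω | ¬ (openGraph ω).Reachable o p ∧ ¬ (openGraph ω).Reachable o q} := by
    ext ω
    simp only [avoidEv, mem_setOf_eq, mem_insert_iff, mem_singleton_iff, forall_eq_or_imp, forall_eq]
  rw [hVo] at key
  rw [Set.inter_right_comm]
  exact key

end DegThreeEnd

end FK
end Summit.CriticalPhenomena.PercolationContinuityZ3.Theorems

end
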